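import Literature.MathematicalPhysics.QuantumLattice.SpinorNormalForm
import HarnessLib

/-!
# The spinor map `SL(2, ℂ) × SL(2, ℂ) → L₊(ℂ)` is onto (proof of (S), hence of (N))

Topic `Literature/MathematicalPhysics/QuantumLattice` (trunk T-AQFT), sequel of
`SpinorNormalForm.lean`, in the decomposition of the named fact (K)
`IsWightmanQFT.extendedTube_continuation_perm_eq` (OS I §5 p. 97). After `SpinorNormalForm`,
`RestrictedLorentzConnected` and `WightmanPermutedTubeDim4`, the four-dimensional instance (K₄)
and Tomozawa's theorem (T) rest on the single named fact (S) `ComplexLorentz.spinorMap_surjective`: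
every `Λ ∈ L₊(ℂ)` is a spinor map `Λ(A, B) : ẑ ↦ A ẑ Bᵀ` with `A, B ∈ SL(2, ℂ)`
(Streater–Wightman (1964), §1-3, eqs. (1-19)–(1-21)). This file **proves (S)**
(`ComplexLorentz.spinorMap_surjective_holds`) and hence **(N)**
(`ComplexLorentz.properComplexLorentz_normalForm_holds`), by an algebraic argument on the images
of the basis vectors ("Pauli triples"):

* for `Λ ∈ L(ℂ)` put `F_μ = (Λe_μ)^` (`ê₀ = 1`, `ê_i = σ_i`, the tree's `pauliMatrix`) and
  `G_i = F_i adj(F₀)`; since `Λ` preserves `det ẑ = η(z, z)` (`det_lcMat`), `det F₀ = 1`,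
  `det F_i = −1`, `det(F_i + F₀) = 0` and `det(F_i + F_j) = −2`, so by polarization
  (`two_trace_mul_adjugate`) and Cayley–Hamilton (`two_mul_self_eq`) the `G_i` are traceless
  involutions which pairwise anticommute;
* an eigenvector `v` of `G₃` for `+1` and `w = G₁ v` form a basis `A₀ = (v, w)` with
  `G₃ A₀ = A₀ σ₃`, `G₁ A₀ = A₀ σ₁` and `G₂ A₀ = ± A₀ σ₂` (`exists_eq_smul_of_eigen`: the
  `∓1`-eigenspaces of the traceless `G₃` are lines); normalizing `det A = 1` and putting
  `Bᵀ = adj(A) F₀` gives `Λ = Λ(A, B)` or `Λ = Λ(A, B) P₂` on the basis, `P₂ : z² ↦ −z²`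
  (`exists_spinorLin_eq_comp_scale2`) — the two components of `L(ℂ)`;
* `det Λ(A, B) = 1` (`det_spinorLin` of `SpinorNormalForm`) and `det P₂ = −1` exclude the second
  alternative on `L₊(ℂ)`: `exists_spinorEquiv_eq`, i.e. (S); with
  `properComplexLorentz_normalForm_of_spinorMap_surjective`, (N).

## Sources

* R. F. Streater, A. S. Wightman, *PCT, Spin and Statistics, and All That*: §1-3, eqs. (1-11)–(1-13)
  (pdf p. 13 of the held 2000 printing), (1-19)–(1-21) and Fig. 1-2 (pdf p. 14: "the proper complex
  Lorentz group is associated with `SL(2,C) ⊗ SL(2,C)`"); §2-4, proof of the Lemma to Thm. 2-11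
  (pdf p. 61: an arbitrary `Λ ∈ L₊(C)` written `ẑ ↦ A ẑ Bᵀ`). [StreaterWightman1964]

## Mathlib / tree

Used: `Matrix.det_fin_two(_of)`, `Matrix.adjugate_fin_two`, `Matrix.mul_adjugate`,
`Matrix.adjugate_mul`, `Matrix.det_adjugate`, `Matrix.exists_mulVec_eq_zero_iff` (non-trivial
kernel iff `det = 0`), `IsAlgClosed.exists_eq_mul_self`, `mul_self_eq_one_iff`,
`LinearMap.det_comp`, `LinearMap.det_toLin'`, `Basis.ext` with `Pi.basisFun`; from the tree
`lcMat`, `ofLcMat`, `lcMat_add`, `lcMat_smul`, `det_lcMat`, `spinorLin`, `lcMat_spinorLin`,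
`det_spinorLin`, `spinorEquiv`, `spinorMap_surjective`,
`properComplexLorentz_normalForm_of_spinorMap_surjective` (`SpinorNormalForm`), `pauliMatrix`,
`pauliMatrix_one_eq/two_eq/three_eq` (`Literature.Analysis.FunctionSpaces.SpinorWightman(Proofs)`),
the light-cone coordinates (`ComplexLorentzNormalForms`), `complexLorentzGroup`,
`properComplexLorentzGroup` (`SchwingerWightman`). No topology, no Lie theory, no null vectors:
the argument is linear algebra in `ℂ²`.

## Design choices

* The helper vocabulary (`ofCols`, `flip2Lin`, `scale2Lin`, the `2 × 2` identities) is local to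
  this proof and lives in the sub-namespace `ComplexLorentz` with the rest of the spinor calculus.
* The dichotomy `exists_spinorLin_eq_comp_scale2` is stated for all of `L(ℂ)` (it identifies the
  improper component as `Λ(A, B) P₂`); only its proper half is needed downstream.
-/

noncomputable section

open Complex Set Matrix
open _root_.Topology

namespace Literature.MathematicalPhysics.QuantumLattice

open Literature.Analysis.FunctionSpaces

namespace ComplexLorentz

/-! ### Complements on `lcMat` and `spinorEquiv` -/

/-- The entries of `ẑ` are the light-cone coordinates `(a p; q b)` (unfolding). [folklore] -/
theorem lcMat_eq (z : Fin 4 → ℂ) : lcMat z = !![aCoord z, pCoord z; qCoord z, bCoord z] := rfl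

/-- Two vectors with the same `ẑ` are equal. [folklore] -/
theorem ext_lcMat {z w : Fin 4 → ℂ} (h : lcMat z = lcMat w) : z = w := by
  rw [← ofLcMat_lcMat z, ← ofLcMat_lcMat w, h]

/-- The linear map underlying `spinorEquiv A B` is `spinorLin A B`. [folklore] -/
theorem coe_spinorEquiv (A B : Matrix (Fin 2) (Fin 2) ℂ) (hA : A.det = 1) (hB : B.det = 1) :
    ((spinorEquiv A B hA hB : (Fin 4 → ℂ) ≃ₗ[ℂ] (Fin 4 → ℂ)) : (Fin 4 → ℂ) →ₗ[ℂ] (Fin 4 → ℂ)) =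
      spinorLin A B := rfl

/-! ### Two-by-two matrix algebra -/

/-- Cayley–Hamilton for `2 × 2` matrices: `X² = (tr X) X − (det X) 1`. [folklore] -/
theorem two_mul_self_eq (X : Matrix (Fin 2) (Fin 2) ℂ) :
    X * X = X.trace • X - X.det • (1 : Matrix (Fin 2) (Fin 2) ℂ) := by
  ext i j
  fin_cases i <;> fin_cases j <;>
    simp [Matrix.mul_apply, Fin.sum_univ_two, Matrix.trace_fin_two, Matrix.det_fin_two] <;> ring

/-- Polarization of the determinant: `tr(X adj Y) = det(X + Y) − det X − det Y`. [folklore] -/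
theorem two_trace_mul_adjugate (X Y : Matrix (Fin 2) (Fin 2) ℂ) :
    (X * adjugate Y).trace = (X + Y).det - X.det - Y.det := by
  rw [Matrix.adjugate_fin_two, Matrix.trace_fin_two, Matrix.det_fin_two, Matrix.det_fin_two,
    Matrix.det_fin_two]
  simp [Matrix.mul_apply, Fin.sum_univ_two]
  ring

/-- `det(X − c) = det X − c tr X + c²` for `2 × 2` matrices. [folklore] -/
theorem two_det_sub_smul_one (X : Matrix (Fin 2) (Fin 2) ℂ) (c : ℂ) :
    (X - c • (1 : Matrix (Fin 2) (Fin 2) ℂ)).det = X.det - c * X.trace + c * c := by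
  rw [Matrix.det_fin_two, Matrix.det_fin_two, Matrix.trace_fin_two]
  simp
  ring

/-- The matrix with columns `v, w`. [folklore] -/
def ofCols (v w : Fin 2 → ℂ) : Matrix (Fin 2) (Fin 2) ℂ := !![v 0, w 0; v 1, w 1]

/-- `det(v, w) = v₀w₁ − w₀v₁`. [folklore] -/
@[simp] theorem det_ofCols (v w : Fin 2 → ℂ) : (ofCols v w).det = v 0 * w 1 - w 0 * v 1 := by
  rw [ofCols, Matrix.det_fin_two_of]

/-- `X (v, w) = (Xv, Xw)`. [folklore] -/
theorem mul_ofCols (X : Matrix (Fin 2) (Fin 2) ℂ) (v w : Fin 2 → ℂ) :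
    X * ofCols v w = ofCols (X *ᵥ v) (X *ᵥ w) := by
  ext i j
  fin_cases i <;> fin_cases j <;> simp [ofCols, Matrix.mul_apply, Matrix.mulVec, dotProduct, Fin.sum_univ_two]

/-- `t (v, w) = (tv, tw)`. [folklore] -/
theorem smul_ofCols (t : ℂ) (v w : Fin 2 → ℂ) : t • ofCols v w = ofCols (t • v) (t • w) := by
  ext i j
  fin_cases i <;> fin_cases j <;> simp [ofCols]

/-- In `ℂ²`: if `w ≠ 0` and `det(v, w) = 0` then `v` is a multiple of `w`. [folklore] -/
theorem exists_eq_smul_of_det_ofCols_eq_zero {v w : Fin 2 → ℂ} (hw : w ≠ 0)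
    (h : (ofCols v w).det = 0) : ∃ c : ℂ, v = c • w := by
  rw [det_ofCols] at h
  by_cases h0 : w 0 = 0
  · have h1 : w 1 ≠ 0 := by
      intro h1; apply hw; funext i; fin_cases i <;> assumption
    refine ⟨v 1 / w 1, funext fun i => ?_⟩
    fin_cases i
    · rw [h0, zero_mul, sub_zero] at h
      have hv0 : v 0 = 0 := (mul_eq_zero.1 h).resolve_right h1
      simp [hv0, h0]
    · simp [div_mul_cancel₀ _ h1]
  · refine ⟨v 0 / w 0, funext fun i => ?_⟩
    fin_cases i
    · simp [div_mul_cancel₀ _ h0]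
    · simp only [Pi.smul_apply, smul_eq_mul, Fin.mk_one]
      rw [div_mul_eq_mul_div, eq_div_iff h0]
      linear_combination -h

/-- `det Λ = 1` on `L₊(ℂ)`, for the underlying linear map. [folklore] -/
theorem det_coe_eq_one_of_mem {Λ : (Fin (3 + 1) → ℂ) ≃ₗ[ℂ] (Fin (3 + 1) → ℂ)}
    (h : Λ ∈ properComplexLorentzGroup 3) :
    LinearMap.det (Λ : (Fin (3 + 1) → ℂ) →ₗ[ℂ] (Fin (3 + 1) → ℂ)) = 1 := by
  rw [← LinearEquiv.coe_det, ((mem_properComplexLorentzGroup_iff Λ).1 h).2, Units.val_one]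

/-- The reflection `z² ↦ −z²` (transposition `ẑ ↦ ẑᵀ`, i.e. `p ↔ q`). [folklore] -/
def flip2Lin : (Fin 4 → ℂ) →ₗ[ℂ] (Fin 4 → ℂ) where
  toFun z := ![z 0, z 1, -z 2, z 3]
  map_add' z w := by funext i; fin_cases i <;> simp; ring
  map_smul' c z := by funext i; fin_cases i <;> simp

/-- `(P₂ z)^ = ẑᵀ`. [folklore] -/
theorem lcMat_flip2Lin (z : Fin 4 → ℂ) : lcMat (flip2Lin z) = (lcMat z)ᵀ := by
  rw [lcMat_eq, lcMat_eq]
  ext i j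
  fin_cases i <;> fin_cases j <;> simp [flip2Lin, aCoord, bCoord, pCoord, qCoord]; ring

/-- `P₂ P₂ = 1`. [folklore] -/
theorem flip2Lin_comp_flip2Lin : flip2Lin ∘ₗ flip2Lin = LinearMap.id := by
  refine LinearMap.ext fun z => funext fun i => ?_
  fin_cases i <;> simp [flip2Lin]

/-! ### Pauli matrices and the images of the basis vectors -/

/-- `ê₀ = 1` (Streater–Wightman (1964), eq. (1-11): `ẑ = z⁰𝟙 + z·σ`). [folklore] -/
theorem lcMat_single_zero : lcMat (Pi.single (0 : Fin 4) 1) = 1 := by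
  rw [lcMat_eq]; ext i j
  fin_cases i <;> fin_cases j <;> simp [aCoord, bCoord, pCoord, qCoord]

/-- `ê₁ = σ₁`. [folklore] -/
theorem lcMat_single_one : lcMat (Pi.single (1 : Fin 4) 1) = pauliMatrix 1 := by
  rw [lcMat_eq, pauliMatrix_one_eq]; ext i j
  fin_cases i <;> fin_cases j <;> simp [aCoord, bCoord, pCoord, qCoord]

/-- `ê₂ = σ₂`. [folklore] -/
theorem lcMat_single_two : lcMat (Pi.single (2 : Fin 4) 1) = pauliMatrix 2 := by
  rw [lcMat_eq, pauliMatrix_two_eq]; ext i j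
  fin_cases i <;> fin_cases j <;> simp [aCoord, bCoord, pCoord, qCoord]

/-- `ê₃ = σ₃`. [folklore] -/
theorem lcMat_single_three : lcMat (Pi.single (3 : Fin 4) 1) = pauliMatrix 3 := by
  rw [lcMat_eq, pauliMatrix_three_eq]; ext i j
  fin_cases i <;> fin_cases j <;> simp [aCoord, bCoord, pCoord, qCoord]

/-- `(v, w) σ₁ = (w, v)`. [folklore] -/
theorem ofCols_mul_pauli₁ (v w : Fin 2 → ℂ) : ofCols v w * pauliMatrix 1 = ofCols w v := by
  rw [pauliMatrix_one_eq]
  ext i j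
  fin_cases i <;> fin_cases j <;> simp [ofCols, Matrix.mul_apply, Fin.sum_univ_two]

/-- `(v, w) σ₂ = (iw, −iv)`. [folklore] -/
theorem ofCols_mul_pauli₂ (v w : Fin 2 → ℂ) : ofCols v w * pauliMatrix 2 = ofCols (I • w) ((-I) • v) := by
  rw [pauliMatrix_two_eq]
  ext i j
  fin_cases i <;> fin_cases j <;> simp [ofCols, Matrix.mul_apply, Fin.sum_univ_two, mul_comm]

/-- `(v, w) σ₃ = (v, −w)`. [folklore] -/
theorem ofCols_mul_pauli₃ (v w : Fin 2 → ℂ) : ofCols v w * pauliMatrix 3 = ofCols v (-w) := by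
  rw [pauliMatrix_three_eq]
  ext i j
  fin_cases i <;> fin_cases j <;> simp [ofCols, Matrix.mul_apply, Fin.sum_univ_two]

/-- A complex Lorentz transformation preserves `det ẑ = η(z, z)`. [folklore] -/
theorem det_lcMat_apply_of_mem {Λ : (Fin (3 + 1) → ℂ) ≃ₗ[ℂ] (Fin (3 + 1) → ℂ)}
    (hΛ : Λ ∈ complexLorentzGroup 3) (z : Fin 4 → ℂ) : (lcMat (Λ z)).det = (lcMat z).det := by
  rw [det_lcMat, det_lcMat]
  exact hΛ z z

/-- If `G M = c M` for an invertible `M` then `G = c`. [folklore] -/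
theorem eq_smul_one_of_mul_eq_smul {G M : Matrix (Fin 2) (Fin 2) ℂ} {c : ℂ} (hM : M.det ≠ 0)
    (h : G * M = c • M) : G = c • (1 : Matrix (Fin 2) (Fin 2) ℂ) := by
  have h1 : G * (M * adjugate M) = c • (M * adjugate M) := by rw [← mul_assoc, h, Matrix.smul_mul]
  rw [Matrix.mul_adjugate, Matrix.mul_smul, mul_one, smul_smul] at h1
  have h2 := congrArg (fun X => (M.det)⁻¹ • X) h1
  simp only [smul_smul, inv_mul_cancel₀ hM, one_smul] at h2
  rw [h2, mul_comm c, ← mul_assoc, inv_mul_cancel₀ hM, one_mul]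

/-- An eigenvector argument in `ℂ²`: if `G₃` is traceless, `G₃ w = ε w` with `w ≠ 0` and
`G₃ u = ε u`, then `u` is a multiple of `w` (otherwise `G₃ = ε`, of trace `2ε ≠ 0`). [folklore] -/
theorem exists_eq_smul_of_eigen {G : Matrix (Fin 2) (Fin 2) ℂ} (hG : G.trace = 0) {ε : ℂ} (hε : ε ≠ 0)
    {u w : Fin 2 → ℂ} (hw : w ≠ 0) (hGw : G *ᵥ w = ε • w) (hGu : G *ᵥ u = ε • u) :
    ∃ c : ℂ, u = c • w := by
  refine exists_eq_smul_of_det_ofCols_eq_zero hw ?_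
  by_contra hdet
  have h1 : G * ofCols u w = ε • ofCols u w := by
    rw [mul_ofCols, hGu, hGw, smul_ofCols]
  have h2 := eq_smul_one_of_mul_eq_smul hdet h1
  have h3 := congrArg Matrix.trace h2
  rw [hG, Matrix.trace_smul, Matrix.trace_one, Fintype.card_fin] at h3
  apply hε
  simpa using h3.symm

/-- The coordinate scaling `z² ↦ s z²`. [folklore] -/
def scale2Lin (s : ℂ) : (Fin 4 → ℂ) →ₗ[ℂ] (Fin 4 → ℂ) where
  toFun z := ![z 0, z 1, s * z 2, z 3]
  map_add' z w := by funext i; fin_cases i <;> simp; ring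
  map_smul' c z := by funext i; fin_cases i <;> simp; ring

/-- `scale2Lin 1 = 1`. [folklore] -/
theorem scale2Lin_one : scale2Lin 1 = LinearMap.id := by
  refine LinearMap.ext fun z => funext fun i => ?_
  fin_cases i <;> simp [scale2Lin]

/-- `scale2Lin (−1) = P₂`. [folklore] -/
theorem scale2Lin_neg_one : scale2Lin (-1) = flip2Lin := by
  refine LinearMap.ext fun z => funext fun i => ?_
  fin_cases i <;> simp [scale2Lin, flip2Lin]

/-- `scale2Lin s` on the standard basis: `e₂ ↦ s e₂`, `e_μ ↦ e_μ` otherwise. [folklore] -/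
theorem scale2Lin_single (s : ℂ) (μ : Fin 4) :
    scale2Lin s (Pi.single μ 1) = (if μ = 2 then s else 1) • Pi.single μ 1 := by
  funext i
  fin_cases μ <;> fin_cases i <;> simp [scale2Lin]

/-- `det P₂ = −1`. [folklore] -/
theorem det_flip2Lin : LinearMap.det flip2Lin = -1 := by
  have h : flip2Lin = Matrix.toLin' (Matrix.diagonal ![(1 : ℂ), 1, -1, 1]) := by
    refine LinearMap.ext fun z => funext fun i => ?_
    fin_cases i <;> simp [flip2Lin, Matrix.mulVec_diagonal]
  rw [h, LinearMap.det_toLin', Matrix.det_diagonal]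
  simp [Fin.prod_univ_four]


/-! ### Surjectivity of the spinor map onto `L₊(ℂ)` -/

/-- **Every complex Lorentz transformation is `Λ(A, B)` or `Λ(A, B) P₂`** with `A, B ∈ SL(2, ℂ)`
and `P₂ : z² ↦ −z²`. Proof: with `F_μ = (Λe_μ)^` and `G_i = F_i F₀⁻¹`, the `G_i` are traceless
(`η(Λe_i, Λe₀) = 0`), of determinant `−1`, hence anticommuting involutions
(`(G_i + G_j)² = 2`); an eigenvector `v` of `G₃` and `w = G₁v` form a basis in which `G₃ = σ₃`,
`G₁ = σ₁` and `G₂ = ±σ₂`. [folklore] -/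
theorem exists_spinorLin_eq_comp_scale2 {Λ : (Fin 4 → ℂ) ≃ₗ[ℂ] (Fin 4 → ℂ)}
    (hΛ : Λ ∈ complexLorentzGroup 3) :
    ∃ (A B : Matrix (Fin 2) (Fin 2) ℂ) (s : ℂ), A.det = 1 ∧ B.det = 1 ∧ (s = 1 ∨ s = -1) ∧
      spinorLin A B = (Λ : (Fin 4 → ℂ) →ₗ[ℂ] (Fin 4 → ℂ)) ∘ₗ scale2Lin s := by
  have hdΛ : ∀ z : Fin 4 → ℂ, (lcMat (Λ z)).det = (lcMat z).det := fun z => by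
    rw [det_lcMat, det_lcMat]; exact hΛ z z
  -- the images of the basis vectors and their Gram data
  set F₀ : Matrix (Fin 2) (Fin 2) ℂ := lcMat (Λ (Pi.single 0 1)) with hF₀
  set F₁ : Matrix (Fin 2) (Fin 2) ℂ := lcMat (Λ (Pi.single 1 1)) with hF₁
  set F₂ : Matrix (Fin 2) (Fin 2) ℂ := lcMat (Λ (Pi.single 2 1)) with hF₂
  set F₃ : Matrix (Fin 2) (Fin 2) ℂ := lcMat (Λ (Pi.single 3 1)) with hF₃
  clear_value F₀ F₁ F₂ F₃
  have hd₀ : F₀.det = 1 := by rw [hF₀, hdΛ, lcMat_single_zero, Matrix.det_one]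
  have hd₁ : F₁.det = -1 := by rw [hF₁, hdΛ, lcMat_single_one, pauliMatrix_one_eq, Matrix.det_fin_two_of]; ring
  have hd₂ : F₂.det = -1 := by
    rw [hF₂, hdΛ, lcMat_single_two, pauliMatrix_two_eq, Matrix.det_fin_two_of]; simp
  have hd₃ : F₃.det = -1 := by rw [hF₃, hdΛ, lcMat_single_three, pauliMatrix_three_eq, Matrix.det_fin_two_of]; ring
  have hsum : ∀ μ ν : Fin 4, (lcMat (Λ (Pi.single μ 1)) + lcMat (Λ (Pi.single ν 1))).det =
      (lcMat (Pi.single μ 1) + lcMat (Pi.single ν 1)).det := fun μ ν => by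
    rw [← lcMat_add, ← map_add, hdΛ, lcMat_add]
  have hs₁₀ : (F₁ + F₀).det = 0 := by
    rw [hF₁, hF₀, hsum, lcMat_single_one, lcMat_single_zero, pauliMatrix_one_eq, Matrix.det_fin_two]; simp
  have hs₂₀ : (F₂ + F₀).det = 0 := by
    rw [hF₂, hF₀, hsum, lcMat_single_two, lcMat_single_zero, pauliMatrix_two_eq, Matrix.det_fin_two]; simp
  have hs₃₀ : (F₃ + F₀).det = 0 := by
    rw [hF₃, hF₀, hsum, lcMat_single_three, lcMat_single_zero, pauliMatrix_three_eq, Matrix.det_fin_two]; simp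
  have hs₁₂ : (F₁ + F₂).det = -2 := by
    rw [hF₁, hF₂, hsum, lcMat_single_one, lcMat_single_two, pauliMatrix_one_eq, pauliMatrix_two_eq, Matrix.det_fin_two]
    simp; ring_nf; rw [I_sq]; ring
  have hs₁₃ : (F₁ + F₃).det = -2 := by
    rw [hF₁, hF₃, hsum, lcMat_single_one, lcMat_single_three, pauliMatrix_one_eq, pauliMatrix_three_eq, Matrix.det_fin_two]
    simp; norm_num
  have hs₂₃ : (F₂ + F₃).det = -2 := by
    rw [hF₂, hF₃, hsum, lcMat_single_two, lcMat_single_three, pauliMatrix_two_eq, pauliMatrix_three_eq, Matrix.det_fin_two]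
    simp; norm_num
  -- the `G_i = F_i F₀⁻¹`: traceless anticommuting involutions
  have hadj₀ : (adjugate F₀).det = 1 := by rw [Matrix.det_adjugate, hd₀, one_pow]
  have htr : ∀ {F : Matrix (Fin 2) (Fin 2) ℂ}, (F + F₀).det = 0 → F.det = -1 →
      (F * adjugate F₀).trace = 0 := by
    intro F h1 h2; rw [two_trace_mul_adjugate, h1, h2, hd₀]; ring
  have hdetG : ∀ {F : Matrix (Fin 2) (Fin 2) ℂ}, F.det = -1 → (F * adjugate F₀).det = -1 := by
    intro F h; rw [Matrix.det_mul, h, hadj₀, mul_one]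
  have hsq : ∀ {G : Matrix (Fin 2) (Fin 2) ℂ}, G.trace = 0 → G.det = -1 → G * G = 1 := by
    intro G h1 h2; rw [two_mul_self_eq, h1, h2, zero_smul, zero_sub, neg_smul, neg_neg, one_smul]
  have hanti : ∀ {F F' : Matrix (Fin 2) (Fin 2) ℂ}, F.det = -1 → F'.det = -1 → (F + F₀).det = 0 →
      (F' + F₀).det = 0 → (F + F').det = -2 →
      (F * adjugate F₀) * (F' * adjugate F₀) + (F' * adjugate F₀) * (F * adjugate F₀) = 0 := by
    intro F F' h1 h2 h3 h4 h5
    have htr' : (F * adjugate F₀ + F' * adjugate F₀).trace = 0 := by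
      rw [Matrix.trace_add, htr h3 h1, htr h4 h2, add_zero]
    have hdet' : (F * adjugate F₀ + F' * adjugate F₀).det = -2 := by
      rw [← add_mul, Matrix.det_mul, h5, hadj₀, mul_one]
    have hsq' := two_mul_self_eq (F * adjugate F₀ + F' * adjugate F₀)
    rw [htr', hdet', zero_smul, zero_sub, add_mul, mul_add, mul_add, hsq (htr h3 h1) (hdetG h1),
      hsq (htr h4 h2) (hdetG h2)] at hsq'
    have e : F * adjugate F₀ * (F' * adjugate F₀) + F' * adjugate F₀ * (F * adjugate F₀) =
        (1 + F * adjugate F₀ * (F' * adjugate F₀) + (F' * adjugate F₀ * (F * adjugate F₀) + 1)) -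
          (2 : ℂ) • (1 : Matrix (Fin 2) (Fin 2) ℂ) := by
      rw [two_smul]; abel
    rw [e, hsq', neg_smul, neg_neg, sub_self]
  set G₁ : Matrix (Fin 2) (Fin 2) ℂ := F₁ * adjugate F₀ with hG₁
  set G₂ : Matrix (Fin 2) (Fin 2) ℂ := F₂ * adjugate F₀ with hG₂
  set G₃ : Matrix (Fin 2) (Fin 2) ℂ := F₃ * adjugate F₀ with hG₃
  clear_value G₁ G₂ G₃
  have hG₁tr : G₁.trace = 0 := by rw [hG₁]; exact htr hs₁₀ hd₁
  have hG₃tr : G₃.trace = 0 := by rw [hG₃]; exact htr hs₃₀ hd₃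
  have hG₃det : G₃.det = -1 := by rw [hG₃]; exact hdetG hd₃
  have hG₁sq : G₁ * G₁ = 1 := hsq hG₁tr (by rw [hG₁]; exact hdetG hd₁)
  have hG₂sq : G₂ * G₂ = 1 := hsq (by rw [hG₂]; exact htr hs₂₀ hd₂) (by rw [hG₂]; exact hdetG hd₂)
  have h13 : G₃ * G₁ = -(G₁ * G₃) := by
    rw [hG₁, hG₃]; exact eq_neg_of_add_eq_zero_right (hanti hd₁ hd₃ hs₁₀ hs₃₀ hs₁₃)
  have h12 : G₁ * G₂ + G₂ * G₁ = 0 := by rw [hG₁, hG₂]; exact hanti hd₁ hd₂ hs₁₀ hs₂₀ hs₁₂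
  have h23 : G₃ * G₂ = -(G₂ * G₃) := by
    rw [hG₂, hG₃]; exact eq_neg_of_add_eq_zero_right (hanti hd₂ hd₃ hs₂₀ hs₃₀ hs₂₃)
  -- an eigenvector `v` of `G₃` for `+1`, and `w = G₁ v`
  have hdet3 : (G₃ - (1 : ℂ) • (1 : Matrix (Fin 2) (Fin 2) ℂ)).det = 0 := by
    rw [two_det_sub_smul_one, hG₃det, hG₃tr]; ring
  obtain ⟨v, hv0, hv⟩ := Matrix.exists_mulVec_eq_zero_iff.2 hdet3
  have hGv : G₃ *ᵥ v = v := by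
    rwa [Matrix.sub_mulVec, Matrix.smul_mulVec, Matrix.one_mulVec, one_smul, sub_eq_zero] at hv
  set w : Fin 2 → ℂ := G₁ *ᵥ v with hw
  clear_value w
  have hG₁w : G₁ *ᵥ w = v := by rw [hw, Matrix.mulVec_mulVec, hG₁sq, Matrix.one_mulVec]
  have hG₃w : G₃ *ᵥ w = -w := by
    rw [hw, Matrix.mulVec_mulVec, h13, Matrix.neg_mulVec, ← Matrix.mulVec_mulVec, hGv]
  have hw0 : w ≠ 0 := fun h => hv0 (by rw [← hG₁w, h, Matrix.mulVec_zero])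
  have hdetA : (ofCols v w).det ≠ 0 := by
    intro h0
    obtain ⟨c, hc⟩ := exists_eq_smul_of_det_ofCols_eq_zero hw0 h0
    have h1 : G₃ *ᵥ v = -v := by rw [hc, Matrix.mulVec_smul, hG₃w, smul_neg]
    rw [hGv] at h1
    apply hv0
    have h2 : (2 : ℂ) • v = 0 := by
      rw [two_smul]
      nth_rewrite 2 [h1]
      exact add_neg_cancel v
    exact (smul_eq_zero.1 h2).resolve_left two_ne_zero
  -- `G₂ v = c w`, `G₂ w = -c v`, `c² = -1`
  obtain ⟨c, hc⟩ : ∃ c : ℂ, G₂ *ᵥ v = c • w :=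
    exists_eq_smul_of_eigen hG₃tr (neg_ne_zero.2 one_ne_zero) hw0 (by rw [hG₃w, neg_one_smul])
      (by rw [Matrix.mulVec_mulVec, h23, Matrix.neg_mulVec, ← Matrix.mulVec_mulVec, hGv, neg_one_smul])
  obtain ⟨c', hc'⟩ : ∃ c' : ℂ, G₂ *ᵥ w = c' • v :=
    exists_eq_smul_of_eigen hG₃tr one_ne_zero hv0 (by rw [hGv, one_smul])
      (by rw [Matrix.mulVec_mulVec, h23, Matrix.neg_mulVec, ← Matrix.mulVec_mulVec, hG₃w,
        Matrix.mulVec_neg, neg_neg, one_smul])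
  have hcc : c * c' = 1 := by
    have h1 : G₂ *ᵥ (G₂ *ᵥ v) = v := by rw [Matrix.mulVec_mulVec, hG₂sq, Matrix.one_mulVec]
    rw [hc, Matrix.mulVec_smul, hc', smul_smul] at h1
    by_contra hne
    apply hv0
    have h2 : (c * c' - 1) • v = 0 := by rw [sub_smul, h1, one_smul, sub_self]
    exact (smul_eq_zero.1 h2).resolve_left (sub_ne_zero.2 hne)
  have hc'c : c' = -c := by
    have e1 : (G₁ * G₂) *ᵥ v = c • v := by rw [← Matrix.mulVec_mulVec, hc, Matrix.mulVec_smul, hG₁w]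
    have e2 : (G₂ * G₁) *ᵥ v = c' • v := by rw [← Matrix.mulVec_mulVec, ← hw, hc']
    have h1 : (G₁ * G₂ + G₂ * G₁) *ᵥ v = 0 := by rw [h12, Matrix.zero_mulVec]
    rw [Matrix.add_mulVec, e1, e2, ← add_smul] at h1
    have h2 : c + c' = 0 := (smul_eq_zero.1 h1).resolve_right hv0
    linear_combination h2
  have hcsq : c * c = -1 := by rw [hc'c] at hcc; linear_combination -hcc
  -- the sign `s = c / i ∈ {±1}`
  set s : ℂ := -I * c with hs
  have hss : s * s = 1 := by rw [hs]; linear_combination (c * c) * I_sq - hcsq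
  have hsc : s * c = I := by rw [hs]; linear_combination (-I) * hcsq
  -- the change of basis
  set A₀ : Matrix (Fin 2) (Fin 2) ℂ := ofCols v w with hA₀
  have r3 : G₃ * A₀ = A₀ * pauliMatrix 3 := by rw [hA₀, mul_ofCols, hGv, hG₃w, ofCols_mul_pauli₃]
  have r1 : G₁ * A₀ = A₀ * pauliMatrix 1 := by rw [hA₀, mul_ofCols, hG₁w, ← hw, ofCols_mul_pauli₁]
  have r2 : (s • G₂) * A₀ = A₀ * pauliMatrix 2 := by
    rw [hA₀, Matrix.smul_mul, mul_ofCols, hc, hc', hc'c, ofCols_mul_pauli₂, smul_ofCols, smul_smul,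
      smul_smul, hsc, mul_neg, hsc]
  obtain ⟨t, ht⟩ := IsAlgClosed.exists_eq_mul_self (A₀.det)⁻¹
  set A : Matrix (Fin 2) (Fin 2) ℂ := t • A₀ with hA
  have hAdet : A.det = 1 := by
    rw [hA, Matrix.det_smul, Fintype.card_fin, pow_two, ← ht, inv_mul_cancel₀ hdetA]
  have R3 : G₃ * A = A * pauliMatrix 3 := by rw [hA, Matrix.mul_smul, r3, Matrix.smul_mul]
  have R1 : G₁ * A = A * pauliMatrix 1 := by rw [hA, Matrix.mul_smul, r1, Matrix.smul_mul]
  have R2 : (s • G₂) * A = A * pauliMatrix 2 := by rw [hA, Matrix.mul_smul, r2, Matrix.smul_mul]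
  set Bt : Matrix (Fin 2) (Fin 2) ℂ := adjugate A * F₀ with hBt
  have hABt : A * Bt = F₀ := by
    rw [hBt, ← mul_assoc, Matrix.mul_adjugate, hAdet, one_smul, one_mul]
  have hBtdet : Bt.det = 1 := by
    rw [hBt, Matrix.det_mul, Matrix.det_adjugate, hAdet, one_pow, hd₀, one_mul]
  have hGF : ∀ F : Matrix (Fin 2) (Fin 2) ℂ, F * adjugate F₀ * F₀ = F := fun F => by
    rw [mul_assoc, Matrix.adjugate_mul, hd₀, one_smul, mul_one]
  refine ⟨A, Btᵀ, s, hAdet, by rwa [Matrix.det_transpose], mul_self_eq_one_iff.1 hss, ?_⟩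
  refine (Pi.basisFun ℂ (Fin 4)).ext fun μ => ext_lcMat ?_
  rw [Pi.basisFun_apply, lcMat_spinorLin, Matrix.transpose_transpose, LinearMap.comp_apply,
    scale2Lin_single, LinearEquiv.coe_coe, map_smul, lcMat_smul]
  fin_cases μ
  · simp only [Fin.zero_eta, Fin.isValue, show (0 : Fin 4) ≠ 2 by decide, if_false, one_smul]
    rw [lcMat_single_zero, mul_one, hABt, hF₀]
  · simp only [Fin.mk_one, Fin.isValue, show (1 : Fin 4) ≠ 2 by decide, if_false, one_smul]
    rw [lcMat_single_one, ← R1, mul_assoc, hABt, ← hF₁, hG₁, hGF]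
  · simp only [Fin.reduceFinMk, Fin.isValue, if_true]
    rw [lcMat_single_two, ← R2, mul_assoc, hABt, ← hF₂, Matrix.smul_mul, hG₂, hGF]
  · simp only [Fin.reduceFinMk, Fin.isValue, show (3 : Fin 4) ≠ 2 by decide, if_false, one_smul]
    rw [lcMat_single_three, ← R3, mul_assoc, hABt, ← hF₃, hG₃, hGF]

/-- **`SL(2, ℂ) × SL(2, ℂ) → L₊(ℂ)` is onto** (Streater–Wightman (1964), §1-3, eq. (1-19) with
Fig. 1-2: "the proper complex Lorentz group is associated with `SL(2,C) ⊗ SL(2,C)`"; used in §2-4,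
proof of the Lemma to Thm. 2-11, where an arbitrary element of `L₊(ℂ)` is written `ẑ ↦ A ẑ Bᵀ`):
every proper complex Lorentz transformation is `Λ(A, B)`; the other possibility `Λ(A, B) P₂` of
`exists_spinorLin_eq_comp_scale2` has determinant `−1`. [cite: StreaterWightman1964, §1-3 eq. (1-19)] -/
theorem exists_spinorEquiv_eq {Λ : (Fin 4 → ℂ) ≃ₗ[ℂ] (Fin 4 → ℂ)} (hΛ : Λ ∈ properComplexLorentzGroup 3) :
    ∃ (A B : Matrix (Fin 2) (Fin 2) ℂ) (hA : A.det = 1) (hB : B.det = 1), Λ = spinorEquiv A B hA hB := by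
  have hΛ' := (mem_properComplexLorentzGroup_iff Λ).1 hΛ
  obtain ⟨A, B, s, hA, hB, hs, heq⟩ := exists_spinorLin_eq_comp_scale2 hΛ'.1
  rcases hs with rfl | rfl
  · refine ⟨A, B, hA, hB, LinearEquiv.toLinearMap_injective ?_⟩
    rw [coe_spinorEquiv, heq, scale2Lin_one, LinearMap.comp_id]
  · exfalso
    have h := congrArg LinearMap.det heq
    rw [det_spinorLin, hA, hB, LinearMap.det_comp, scale2Lin_neg_one, det_flip2Lin,
      det_coe_eq_one_of_mem hΛ] at h
    norm_num at h



/-- **(S) holds: the spinor map `SL(2, ℂ) × SL(2, ℂ) → L₊(ℂ)` is onto** (Streater–Wightman (1964),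
§1-3, eqs. (1-19)–(1-21) with Fig. 1-2; the named fact `spinorMap_surjective` of
`SpinorNormalForm`, discharged). [cite: StreaterWightman1964, §1-3 eqs. (1-19)–(1-21)] -/
theorem spinorMap_surjective_holds : spinorMap_surjective := fun _ hΛ => exists_spinorEquiv_eq hΛ

/-- **(N) holds: normal forms of proper complex Lorentz transformations under `L↑₊ × L↑₊`**
(Streater–Wightman (1964), §2-4, proof of the Lemma to Thm. 2-11, eqs. (2-87)–(2-88); the named
fact `properComplexLorentz_normalForm` of `ComplexLorentzNormalForms`, discharged from (S) by
`properComplexLorentz_normalForm_of_spinorMap_surjective`).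
[cite: StreaterWightman1964, §2-4 (proof of the Lemma to Thm 2-11, eqs (2-87)–(2-88))] -/
theorem properComplexLorentz_normalForm_holds : properComplexLorentz_normalForm :=
  properComplexLorentz_normalForm_of_spinorMap_surjective spinorMap_surjective_holds

end ComplexLorentz

end Literature.MathematicalPhysics.QuantumLattice
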